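import Literature.Combinatorics.StablePolynomials.DiskInversionClosed
import Literature.Combinatorics.StablePolynomials.ExteriorBallTransport
import Mathlib.Topology.MetricSpace.Thickening
import HarnessLib

/-!
# Symmetrization for closed circular domains (Borcea–Brändén II, Theorem 1.2 and Proposition 1.3 for
# closed discs and for closed exteriors of discs)

J. Borcea, P. Brändén, *The Lee–Yang and Pólya–Schur programs. II.*, Comm. Pure Appl. Math. 62 (2009)
1595–1631 (arXiv:0809.3087), §1:

> **Theorem 1.2.** Let `C` be an open or closed circular domain. (a) If `C` is convex then the
> symmetrization operator `Sym` preserves `C`-stability on multi-affine polynomials […]. (b) If `C` is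
> non-convex and `f ∈ ℂ_{(1ⁿ)}[z_1,…,z_n]` is `C`-stable and such that all variables are active in `f` […]
> then `Sym(f)` is `C`-stable.
>
> **Proposition 1.3.** […] `C` be an open or closed circular domain, `0 ≤ p ≤ 1`, and `τ = (ij) ∈ 𝔖_n` be a
> transposition. (a) If `C` is convex and `f` is `C`-stable then so is `pf + (1-p)τ(f)`. (b) If `C` is
> non-convex and `f` is `C`-stable and depending on both `z_i` and `z_j` then `pf + (1-p)τ(f)` is also
> `C`-stable.

The tree has the open cases (`SymmetrizationDisk.lean`: open discs; `SymmetrizationExteriorDisk.lean`,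
`ExteriorBallTransport.lean`: open exteriors). This file adds the **closed** bounded and unbounded circular
domains: closed discs `{|z - c| ≤ r}` — by compactness a polynomial with no zeros on the closed polydisc has
none on a slightly larger open polydisc (`exists_gt_radius_of_closedPolydisc`), so the open case applies — and
closed exteriors `{|z - c| ≥ r}`, transported to `ℂ ∖ 𝔻` by `z ↦ rz + c` and then to the closed disc `𝔻̄` by
the closed version of Corollary 1.7 (`DiskInversionClosed.lean`), exactly as in the open case.

## Main results (namespace `Literature.Combinatorics.StablePolynomials`)

* `exists_mem_closedPolydisc_dist_lt`, **`exists_gt_radius_of_closedPolydisc`**.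
* **`symmetrization_ne_zero_of_mem_closedBall`**, **`partialSymmetrization_ne_zero_of_mem_closedBall`** —
  Thm. 1.2 (a), Prop. 1.3 (a) for closed discs.
* **`symmetrization_closedExteriorDiskStable`**, **`partialSymmetrization_closedExteriorDiskStable`** —
  Thm. 1.2 (b), Prop. 1.3 (b) for `C = ℂ ∖ 𝔻`; `symmetrization_closedExteriorBallStable`,
  `partialSymmetrization_closedExteriorBallStable` — for `C = {|z - c| ≥ r}`.

## References

* [BorceaBranden2009II] J. Borcea, P. Brändén, Comm. Pure Appl. Math. 62 (2009) 1595–1631, §1 Thm. 1.2,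
  Prop. 1.3, Cor. 1.7.
-/

noncomputable section

open MvPolynomial Finset Metric

namespace Literature.Combinatorics.StablePolynomials

variable {σ : Type*} [Fintype σ] [DecidableEq σ]

/-! ## §1 From the closed polydisc to a slightly larger open polydisc -/

section Compact

omit [DecidableEq σ] in
/-- Radial projection onto the closed polydisc: a point with all `|z_i - c| < r + δ` is within (sup-)distance
`δ` of a point of `{|w_i - c| ≤ r}ⁿ` (`r ≥ 0`). [cite: BorceaBranden2009II, §1 Thm. 1.2 (closed circular
domains)] -/
theorem exists_mem_closedPolydisc_dist_lt (c : ℂ) {r δ : ℝ} (hr : 0 ≤ r) (hδ : 0 < δ) {z : σ → ℂ}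
    (hz : ∀ i, ‖z i - c‖ < r + δ) : ∃ w : σ → ℂ, (∀ i, ‖w i - c‖ ≤ r) ∧ dist z w < δ := by
  classical
  refine ⟨fun i => if ‖z i - c‖ ≤ r then z i else c + ((r : ℂ) / ‖z i - c‖) * (z i - c), fun i => ?_,
    (dist_pi_lt_iff hδ).2 fun i => ?_⟩
  · dsimp only
    by_cases h : ‖z i - c‖ ≤ r
    · rw [if_pos h]; exact h
    · have hpos : 0 < ‖z i - c‖ := lt_of_le_of_lt hr (not_le.1 h)
      rw [if_neg h, add_sub_cancel_left, norm_mul, norm_div, Complex.norm_real, Complex.norm_real,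
        Real.norm_of_nonneg hr, Real.norm_of_nonneg hpos.le, div_mul_cancel₀ _ hpos.ne']
  · by_cases h : ‖z i - c‖ ≤ r
    · rw [if_pos h, dist_self]; exact hδ
    · have hpos : 0 < ‖z i - c‖ := lt_of_le_of_lt hr (not_le.1 h)
      rw [if_neg h, dist_eq_norm, show z i - (c + (r : ℂ) / ‖z i - c‖ * (z i - c)) =
        ((1 : ℂ) - (r : ℂ) / ‖z i - c‖) * (z i - c) by ring, norm_mul,
        show (1 : ℂ) - (r : ℂ) / ‖z i - c‖ = ((1 - r / ‖z i - c‖ : ℝ) : ℂ) by push_cast; ring,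
        Complex.norm_real, Real.norm_of_nonneg (by
          rw [sub_nonneg, div_le_one hpos]; exact (not_le.1 h).le), sub_mul, one_mul,
        div_mul_cancel₀ _ hpos.ne']
      linarith [hz i]

omit [DecidableEq σ] in
/-- **Closed ⟹ slightly larger open.** If the polynomial `f` has no zeros on the closed polydisc
`{|z_i - c| ≤ r}ⁿ` (`r ≥ 0`) then, by compactness, it has none on the open polydisc `{|z_i - c| < r'}ⁿ` for
some `r' > r`. [cite: BorceaBranden2009II, §1 Thm. 1.2 / Prop. 1.3 ("`C` … an open or closed circular
domain")] -/
theorem exists_gt_radius_of_closedPolydisc {f : MvPolynomial σ ℂ} (c : ℂ) {r : ℝ} (hr : 0 ≤ r)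
    (hs : ∀ z : σ → ℂ, (∀ i, ‖z i - c‖ ≤ r) → eval z f ≠ 0) :
    ∃ r' : ℝ, r < r' ∧ ∀ z : σ → ℂ, (∀ i, ‖z i - c‖ < r') → eval z f ≠ 0 := by
  set K : Set (σ → ℂ) := Set.pi Set.univ fun _ => closedBall c r with hK
  set N : Set (σ → ℂ) := {z | eval z f = 0} with hN
  have hKc : IsCompact K := isCompact_univ_pi fun _ => isCompact_closedBall c r
  have hNc : IsClosed N := isClosed_eq (continuous_eval f) continuous_const
  have hdisj : Disjoint K N := Set.disjoint_left.2 fun z hzK hzN =>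
    hs z (fun i => mem_closedBall_iff_norm.1 (hzK i (Set.mem_univ i))) hzN
  obtain ⟨δ, hδ, hKN⟩ := hdisj.exists_thickenings hKc hNc
  refine ⟨r + δ, lt_add_of_pos_right r hδ, fun z hz hz0 => ?_⟩
  obtain ⟨w, hw, hzw⟩ := exists_mem_closedPolydisc_dist_lt c hr hδ hz
  have hzK : z ∈ thickening δ K :=
    mem_thickening_iff.2 ⟨w, fun i _ => mem_closedBall_iff_norm.2 (hw i), hzw⟩
  have hzN : z ∈ thickening δ N := self_subset_thickening hδ N hz0
  exact Set.disjoint_left.1 hKN hzK hzN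

end Compact

/-! ## §2 Theorem 1.2 (a) and Proposition 1.3 (a) for closed discs -/

section ClosedDisc

/-- **Borcea–Brändén II, Theorem 1.2 (a) for a closed disc `C = {|z - c| ≤ r}`** (`r > 0`): if the
multi-affine `f` has no zeros in `Cⁿ` then neither has `Sym(f)`. [cite: BorceaBranden2009II, §1 Thm. 1.2 (a)
(`C` a closed disk)] -/
theorem symmetrization_ne_zero_of_mem_closedBall {f : MvPolynomial σ ℂ} (hf : IsMultiAffine f) (c : ℂ)
    {r : ℝ} (hr : 0 < r) (hs : ∀ z : σ → ℂ, (∀ i, ‖z i - c‖ ≤ r) → eval z f ≠ 0) (z : σ → ℂ)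
    (hz : ∀ i, ‖z i - c‖ ≤ r) : eval z (StablePolynomials.symmetrization f) ≠ 0 := by
  obtain ⟨r', hrr', hs'⟩ := exists_gt_radius_of_closedPolydisc c hr.le hs
  exact symmetrization_ne_zero_of_mem_ball hf c (hr.trans hrr') hs' z fun i => (hz i).trans_lt hrr'

/-- **Borcea–Brändén II, Proposition 1.3 (a) for a closed disc `C = {|z - c| ≤ r}`** (`r > 0`).
[cite: BorceaBranden2009II, §1 Prop. 1.3 (a) (`C` a closed disk)] -/
theorem partialSymmetrization_ne_zero_of_mem_closedBall {f : MvPolynomial σ ℂ} (hf : IsMultiAffine f)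
    (c : ℂ) {r : ℝ} (hr : 0 < r) (hs : ∀ z : σ → ℂ, (∀ i, ‖z i - c‖ ≤ r) → eval z f ≠ 0) (a b : σ)
    {θ : ℝ} (h0 : 0 ≤ θ) (h1 : θ ≤ 1) (z : σ → ℂ) (hz : ∀ i, ‖z i - c‖ ≤ r) :
    eval z ((θ : ℂ) • f + (1 - (θ : ℂ)) • MvPolynomial.rename (Equiv.swap a b) f) ≠ 0 := by
  obtain ⟨r', hrr', hs'⟩ := exists_gt_radius_of_closedPolydisc c hr.le hs
  exact partialSymmetrization_ne_zero_of_mem_ball hf c (hr.trans hrr') hs' a b h0 h1 z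
    fun i => (hz i).trans_lt hrr'

/-- The closed unit disc: `Sym` of a `𝔻̄`-stable multi-affine polynomial is `𝔻̄`-stable.
[cite: BorceaBranden2009II, §1 Thm. 1.2 (a) (`C = 𝔻̄`)] -/
theorem symmetrization_closedDiskStable {f : MvPolynomial σ ℂ} (hf : IsMultiAffine f)
    (hs : ∀ z : σ → ℂ, (∀ i, ‖z i‖ ≤ 1) → eval z f ≠ 0) (z : σ → ℂ) (hz : ∀ i, ‖z i‖ ≤ 1) :
    eval z (StablePolynomials.symmetrization f) ≠ 0 :=
  symmetrization_ne_zero_of_mem_closedBall hf 0 zero_lt_one (fun w hw => hs w fun i => by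
    simpa using hw i) z fun i => by simpa using hz i

/-- The closed unit disc: partial symmetrization of a `𝔻̄`-stable multi-affine polynomial is `𝔻̄`-stable.
[cite: BorceaBranden2009II, §1 Prop. 1.3 (a) (`C = 𝔻̄`)] -/
theorem partialSymmetrization_closedDiskStable {f : MvPolynomial σ ℂ} (hf : IsMultiAffine f)
    (hs : ∀ z : σ → ℂ, (∀ i, ‖z i‖ ≤ 1) → eval z f ≠ 0) (a b : σ) {θ : ℝ} (h0 : 0 ≤ θ) (h1 : θ ≤ 1)
    (z : σ → ℂ) (hz : ∀ i, ‖z i‖ ≤ 1) :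
    eval z ((θ : ℂ) • f + (1 - (θ : ℂ)) • MvPolynomial.rename (Equiv.swap a b) f) ≠ 0 :=
  partialSymmetrization_ne_zero_of_mem_closedBall hf 0 zero_lt_one (fun w hw => hs w fun i => by
    simpa using hw i) a b h0 h1 z fun i => by simpa using hz i

end ClosedDisc

/-! ## §3 Theorem 1.2 (b) and Proposition 1.3 (b) for closed exteriors -/

section ClosedExterior

/-- **Borcea–Brändén II, Theorem 1.2 (b) for `C = ℂ ∖ 𝔻`** (the closed exterior of the unit disc): if `f` is
multi-affine with all variables active and has no zeros with all `|z_i| ≥ 1`, then neither has `Sym(f)`.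
Transport along `I_{(1ⁿ)}` (Cor. 1.7, closed version) to the closed disc. [cite: BorceaBranden2009II, §1
Thm. 1.2 (b) (`C` closed non-convex)] -/
theorem symmetrization_closedExteriorDiskStable {f : MvPolynomial σ ℂ} (hact : ∀ i, f.degreeOf i = 1)
    (hs : ∀ z : σ → ℂ, (∀ i, 1 ≤ ‖z i‖) → eval z f ≠ 0) (z : σ → ℂ) (hz : ∀ i, 1 ≤ ‖z i‖) :
    eval z (symmetrization f) ≠ 0 := by
  set κ := degVec f with hκdef
  have hκ1 : ∀ i, κ i = 1 := fun i => by rw [hκdef, degVec_apply, hact i]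
  have hf : IsMultiAffine f := fun i => (hact i).le
  have hκperm : ∀ (π : Equiv.Perm σ) i, κ (π i) = κ i := fun π i => by rw [hκ1, hκ1]
  have hg : ∀ u : σ → ℂ, (∀ i, ‖u i‖ ≤ 1) → eval u (invOp κ f) ≠ 0 := fun u hu =>
    invOp_closedDiskStable hs u hu
  have hgma : IsMultiAffine (invOp κ f) := isMultiAffine_invOp (fun i => (hκ1 i).le) f
  have hSg := symmetrization_closedDiskStable hgma hg
  rw [symmetrization_invOp hκperm] at hSg
  have hfits : ∀ α ∈ (symmetrization f).support, α ≤ κ := fun α hα =>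
    Finsupp.le_def.2 fun i => (hκ1 i).symm ▸ (monomial_le_degreeOf i hα).trans (hf.symmetrization i)
  have h := invOp_closedExteriorDiskStable (invOp_fits κ (symmetrization f)) hSg z hz
  rwa [invOp_invOp hfits] at h

/-- **Borcea–Brändén II, Proposition 1.3 (b) for `C = ℂ ∖ 𝔻`**: if the multi-affine `f` depends on both `z_a`
and `z_b` and has no zeros with all `|z_i| ≥ 1`, then neither has `θ f + (1-θ) (a b)(f)`, `0 ≤ θ ≤ 1`.
[cite: BorceaBranden2009II, §1 Prop. 1.3 (b) (`C` closed non-convex)] -/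
theorem partialSymmetrization_closedExteriorDiskStable {f : MvPolynomial σ ℂ} (hf : IsMultiAffine f)
    {a b : σ} (ha : f.degreeOf a = 1) (hb : f.degreeOf b = 1)
    (hs : ∀ z : σ → ℂ, (∀ i, 1 ≤ ‖z i‖) → eval z f ≠ 0) {θ : ℝ} (h0 : 0 ≤ θ) (h1 : θ ≤ 1)
    (z : σ → ℂ) (hz : ∀ i, 1 ≤ ‖z i‖) :
    eval z ((θ : ℂ) • f + (1 - (θ : ℂ)) • rename (Equiv.swap a b) f) ≠ 0 := by
  set κ := degVec f with hκdef
  have hκle : ∀ i, κ i ≤ 1 := fun i => by rw [hκdef, degVec_apply]; exact hf i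
  have hκswap : ∀ i, κ (Equiv.swap a b i) = κ i := fun i => by
    have hκa : κ a = 1 := by rw [hκdef, degVec_apply, ha]
    have hκb : κ b = 1 := by rw [hκdef, degVec_apply, hb]
    by_cases hia : i = a
    · rw [hia, Equiv.swap_apply_left, hκa, hκb]
    · by_cases hib : i = b
      · rw [hib, Equiv.swap_apply_right, hκa, hκb]
      · rw [Equiv.swap_apply_of_ne_of_ne hia hib]
  have hg : ∀ u : σ → ℂ, (∀ i, ‖u i‖ ≤ 1) → eval u (invOp κ f) ≠ 0 := fun u hu =>
    invOp_closedDiskStable hs u hu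
  have hgma : IsMultiAffine (invOp κ f) := isMultiAffine_invOp hκle f
  have hG := partialSymmetrization_closedDiskStable hgma hg a b h0 h1
  rw [← invOp_rename (Equiv.swap a b) hκswap, ← invOp_smul, ← invOp_smul, ← invOp_add] at hG
  set F := (θ : ℂ) • f + (1 - (θ : ℂ)) • rename (⇑(Equiv.swap a b)) f with hF
  have hfits : ∀ α ∈ F.support, α ≤ κ := by
    intro α hα
    rcases Finset.mem_union.1 (support_add hα) with h | h
    · exact le_degVec (mem_support_iff.1 (support_smul h))
    · have h' := support_smul h
      rw [support_rename_of_injective (Equiv.swap a b).injective, Finset.mem_image] at h'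
      obtain ⟨β, hβ, rfl⟩ := h'
      refine Finsupp.le_def.2 fun j => ?_
      obtain ⟨i, rfl⟩ := (Equiv.swap a b).surjective j
      rw [mapDomain_perm_apply, hκswap]
      exact Finsupp.le_def.1 (le_degVec (mem_support_iff.1 hβ)) i
  have h := invOp_closedExteriorDiskStable (invOp_fits κ F) hG z hz
  rwa [invOp_invOp hfits] at h

omit [Fintype σ] [DecidableEq σ] in
/-- The pull-back `f(ru + c)` of a polynomial with no zeros in `{|z_i - c| ≥ r}ⁿ` is `(ℂ ∖ 𝔻)ⁿ`-stable.
[cite: BorceaBranden2009II, §1 Lemma 1.8 (affine `Φ_κ`)] -/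
theorem closedExteriorDiskStable_affineSubst {f : MvPolynomial σ ℂ} (c : ℂ) {r : ℝ} (hr : 0 < r)
    (hs : ∀ z : σ → ℂ, (∀ i, r ≤ ‖z i - c‖) → eval z f ≠ 0) (u : σ → ℂ) (hu : ∀ i, 1 ≤ ‖u i‖) :
    eval u (affineSubst r c f) ≠ 0 := by
  rw [eval_affineSubst]
  refine hs _ fun i => ?_
  rw [add_sub_cancel_right, norm_mul, Complex.norm_real, Real.norm_of_nonneg hr.le]
  calc r = r * 1 := (mul_one r).symm
    _ ≤ r * ‖u i‖ := mul_le_mul_of_nonneg_left (hu i) hr.le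

omit [Fintype σ] [DecidableEq σ] in
/-- From the pull-back back to `{|z_i - c| ≥ r}ⁿ`. [cite: BorceaBranden2009II, §1 Lemma 1.8] -/
theorem eval_ne_zero_of_closedExteriorDiskStable_affineSubst {g : MvPolynomial σ ℂ} (c : ℂ) {r : ℝ}
    (hr : 0 < r) (hg : ∀ u : σ → ℂ, (∀ i, 1 ≤ ‖u i‖) → eval u (affineSubst r c g) ≠ 0) (z : σ → ℂ)
    (hz : ∀ i, r ≤ ‖z i - c‖) : eval z g ≠ 0 := by
  have hr0 : (r : ℂ) ≠ 0 := Complex.ofReal_ne_zero.2 hr.ne'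
  have h := hg (fun i => (z i - c) / r) fun i => by
    rw [norm_div, Complex.norm_real, Real.norm_of_nonneg hr.le, le_div_iff₀ hr, one_mul]
    exact hz i
  rw [eval_affineSubst] at h
  have hz' : (fun i => (r : ℂ) * ((z i - c) / r) + c) = z := funext fun i => by
    field_simp
    ring
  rwa [hz'] at h

/-- **Theorem 1.2 (b) for `C = {|z - c| ≥ r}`** (`r > 0`, any closed non-convex circular domain).
[cite: BorceaBranden2009II, §1 Thm. 1.2 (b)] -/
theorem symmetrization_closedExteriorBallStable {f : MvPolynomial σ ℂ} (hact : ∀ i, f.degreeOf i = 1)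
    (c : ℂ) {r : ℝ} (hr : 0 < r) (hs : ∀ z : σ → ℂ, (∀ i, r ≤ ‖z i - c‖) → eval z f ≠ 0) (z : σ → ℂ)
    (hz : ∀ i, r ≤ ‖z i - c‖) : eval z (symmetrization f) ≠ 0 := by
  have hr0 : (r : ℂ) ≠ 0 := Complex.ofReal_ne_zero.2 hr.ne'
  have hF := symmetrization_closedExteriorDiskStable (f := affineSubst r c f)
    (fun i => by rw [degreeOf_affineSubst hr0, hact i]) (closedExteriorDiskStable_affineSubst c hr hs)
  rw [symmetrization_affineSubst] at hF
  exact eval_ne_zero_of_closedExteriorDiskStable_affineSubst c hr hF z hz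

/-- **Proposition 1.3 (b) for `C = {|z - c| ≥ r}`** (`r > 0`). [cite: BorceaBranden2009II, §1 Prop. 1.3 (b)] -/
theorem partialSymmetrization_closedExteriorBallStable {f : MvPolynomial σ ℂ} (hf : IsMultiAffine f)
    {a b : σ} (ha : f.degreeOf a = 1) (hb : f.degreeOf b = 1) (c : ℂ) {r : ℝ} (hr : 0 < r)
    (hs : ∀ z : σ → ℂ, (∀ i, r ≤ ‖z i - c‖) → eval z f ≠ 0) {θ : ℝ} (h0 : 0 ≤ θ) (h1 : θ ≤ 1)
    (z : σ → ℂ) (hz : ∀ i, r ≤ ‖z i - c‖) :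
    eval z ((θ : ℂ) • f + (1 - (θ : ℂ)) • rename (Equiv.swap a b) f) ≠ 0 := by
  have hr0 : (r : ℂ) ≠ 0 := Complex.ofReal_ne_zero.2 hr.ne'
  have hF := partialSymmetrization_closedExteriorDiskStable (hf.affineSubst r c)
    (by rw [degreeOf_affineSubst hr0, ha]) (by rw [degreeOf_affineSubst hr0, hb])
    (closedExteriorDiskStable_affineSubst c hr hs) h0 h1
  have hlin : (θ : ℂ) • affineSubst r c f + (1 - (θ : ℂ)) • rename (⇑(Equiv.swap a b)) (affineSubst r c f) =
      affineSubst r c ((θ : ℂ) • f + (1 - (θ : ℂ)) • rename (⇑(Equiv.swap a b)) f) := by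
    rw [map_add, map_smul, map_smul, rename_perm_affineSubst]
  simp only [hlin] at hF
  exact eval_ne_zero_of_closedExteriorDiskStable_affineSubst c hr hF z hz

end ClosedExterior

end Literature.Combinatorics.StablePolynomials

end
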